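import Summits.CriticalPhenomena.PercolationContinuityZ3.Theorems.PercNearOneGluingNoHeavyQuantIndepBlobTwoLightCells
import Summits.CriticalPhenomena.PercolationContinuityZ3.Theorems.PercNearOneGluingNoHeavyQuantIndepBlobTwoLightCellsHigh
import Summits.CriticalPhenomena.PercolationContinuityZ3.Theorems.PercNearOneGluingNoHeavyQuantIndepBlobPairChords
import Summits.CriticalPhenomena.PercolationContinuityZ3.Theorems.PercNearOneGluingNoHeavyQuantIndepBlobMergeToOneLight
import HarnessLib

/-!
# QUANT lane R8, T-DIB: Conjecture DIB\* with TWO sub-floor blobs on the whole corner `x > 1/2`, heavy mass `≤ 2j` —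
# merge one light (λ⁺) or certify by chords (two-point reduction + seven cells)

builds on p205010 (kernel theorem, internal audit signed; external expert review pending)

Support file (`--supports stmt-CriticalPhenomena-4575`), QUANT lane seat prim-quant-p1 (gen 12); memo
`run/shared/lean/prim/quant/P1-SURPLUS.md` §23.  Theorems only; no definitions, no sorries, standard axioms.

**Theorem** (`Quant.IndepBlob.tail_ge_of_twoLights_corner`).  Floor `1/2 < x < 1`; gates in `[0,1]`; two distinguished LIGHT blobs
`ℓ₁ ≠ ℓ₂` with gates in `[x², x)` and sizes `1 ≤ a ℓ₂ ≤ a ℓ₁ ≤ j`; every other blob heavy (`x ≤ p k`) with total heavy size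
`A = Σ_{k ≠ ℓ₁,ℓ₂} a k ≤ 2j`; DIB\* credit `2j < Σ_{k ≠ ℓ₁,ℓ₂} a k·p k + a ℓ₁ κ_x(p ℓ₁) + a ℓ₂ κ_x(p ℓ₂)`.  Then `x ≤ P(N ≥ j+1)`.
With the kernel rows for heavy total `≥ 2j+1` (lead g15 `sizeRow_with_extra_blobs`) and floors `≤ 1/2` (`dibStar_of_le_half`) this is
Conjecture DIB\* (`…QuantDIBStar`) for every system with at most two light blobs of positive size (the zero- or one-light cases are kernel:
`far_indepBlob`, `tail_ge_of_oneLight_allFloors`); the packaging across floors is left to the typer.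

PROOF (P1-SURPLUS §23; Conjecture J for two lights).  (A) If a light blob `ℓ` is heavy-mergeable (`j ≤ p ℓ · A`) then p1 g11's λ⁺
`tail_ge_of_heavyMerge_oneLight` (merge it into the heavies, then the one-light row at every floor) applies with `x₀ =` the other light.
(B) Otherwise `p ℓ₁·A < j` and `p ℓ₂·A < j` (`tail_ge_of_twoLights_noMerge`): by the two-point reduction of the heavy side
(`tail_ge_of_pairChords`) it suffices to check every chord `(n₁, n₂)`, `n₁ < m < n₂ ≤ A`, of `n ↦ F(j+1−n)` (`F` the tail of the light
pair).  The level of the upper end is `1 − (1−p₁)(1−p₂)` (`n₂ ≤ j`, cells C5–C7 of `…TwoLightCells`) or `1` (`n₂ ≥ j+1`; then the chord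
through `A` is the worst one, `twoLight_chord_top_reduce`, and cells C1–C4 of `…TwoLightCellsHigh` apply; C1 is where (B) is used).

* `Quant.IndepBlob.twoLight_chord_top_reduce` — the reduction `n₂ ↦ A` for chords whose upper end has level `1`.
* `Quant.IndepBlob.tail_ge_of_twoLights_noMerge` — case (B).
* `Quant.IndepBlob.tail_ge_of_twoLights_corner` — the theorem.
[cite: KozmaNitzan2024, Conjecture 3 (p. 15)] (the gluing rows served); the theorem is [this work].
-/

namespace Summit.CriticalPhenomena.PercolationContinuityZ3.Theorems

namespace Quant

namespace IndepBlob

open Finset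

/-- Reduction of a chord with top level `1` to the chord through `A`: if `x(A − n₁) ≤ (A − m)f + (m − n₁)` with `f ≤ x` and
`m ≤ n₂ ≤ A`, then `x(n₂ − n₁) ≤ (n₂ − m)f + (m − n₁)`; and if `x ≤ f` the latter holds outright (`n₁ ≤ m`). [this work] -/
theorem twoLight_chord_top_reduce (x f n₁ n₂ A m : ℝ) (hn1 : n₁ ≤ m) (hm : m ≤ n₂) (hA : n₂ ≤ A)
    (h : f ≤ x → x * (A - n₁) ≤ (A - m) * f + (m - n₁) * 1) (hx1 : x ≤ 1) :
    x * (n₂ - n₁) ≤ (n₂ - m) * f + (m - n₁) * 1 := by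
  by_cases hf : f ≤ x
  · have h1 := h hf
    have h2 : 0 ≤ (A - n₂) * (x - f) := mul_nonneg (by linarith) (by linarith)
    nlinarith [h1, h2]
  · have hf' : x < f := not_le.mp hf
    have h1 : (n₂ - m) * x ≤ (n₂ - m) * f := mul_le_mul_of_nonneg_left hf'.le (by linarith)
    nlinarith [h1]

/-- **Case (B): neither light blob is heavy-mergeable.**  Hypotheses as in `tail_ge_of_twoLights_corner` plus `p ℓ₁·A < j`,
`p ℓ₂·A < j` (`A` the heavy total); conclusion `x ≤ P(N ≥ j+1)`. [this work] -/
theorem tail_ge_of_twoLights_noMerge {κ : Type*} [Fintype κ] [DecidableEq κ] (p : κ → ℝ) (a : κ → ℕ) (x : ℝ) (j : ℕ)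
    (hx : 1 / 2 < x) (hx1 : x < 1) (hp0 : ∀ i, 0 ≤ p i) (hp1 : ∀ i, p i ≤ 1) (ℓ₁ ℓ₂ : κ) (hne : ℓ₁ ≠ ℓ₂)
    (hsz : a ℓ₂ ≤ a ℓ₁) (hb1 : 1 ≤ a ℓ₂) (hBj : a ℓ₁ ≤ j)
    (h1lo : x ^ 2 ≤ p ℓ₁) (h1hi : p ℓ₁ < x) (h2lo : x ^ 2 ≤ p ℓ₂) (h2hi : p ℓ₂ < x)
    (hheavy : ∀ k, k ≠ ℓ₁ → k ≠ ℓ₂ → x ≤ p k)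
    (hA : ∑ k ∈ (insert ℓ₂ (insert ℓ₁ (∅ : Finset κ)))ᶜ, a k ≤ 2 * j)
    (hnm1 : p ℓ₁ * ((∑ k ∈ (insert ℓ₂ (insert ℓ₁ (∅ : Finset κ)))ᶜ, a k : ℕ) : ℝ) < j)
    (hnm2 : p ℓ₂ * ((∑ k ∈ (insert ℓ₂ (insert ℓ₁ (∅ : Finset κ)))ᶜ, a k : ℕ) : ℝ) < j)
    (hcredit : (2 * j : ℝ) < (∑ k ∈ (insert ℓ₂ (insert ℓ₁ (∅ : Finset κ)))ᶜ, (a k : ℝ) * p k) +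
      (a ℓ₁ : ℝ) * ((p ℓ₁ - x ^ 2) / (1 - x)) + (a ℓ₂ : ℝ) * ((p ℓ₂ - x ^ 2) / (1 - x))) :
    x ≤ ∑ s : Finset κ, (∏ i, (if i ∈ s then p i else 1 - p i)) * (if j + 1 ≤ ∑ i ∈ s, a i then (1 : ℝ) else 0) := by
  set S : Finset κ := insert ℓ₂ (insert ℓ₁ (∅ : Finset κ)) with hS
  set A : ℕ := ∑ k ∈ Sᶜ, a k with hAdef
  set m : ℝ := ∑ k ∈ Sᶜ, (a k : ℝ) * p k with hmdef
  have hε : 0 < 1 - x := by linarith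
  set ac : ℝ := (p ℓ₁ - x ^ 2) / (1 - x) with hac
  set cc : ℝ := (p ℓ₂ - x ^ 2) / (1 - x) with hcc
  have hG : p ℓ₁ = x ^ 2 + (1 - x) * ac := by rw [hac]; field_simp; ring
  have hg : p ℓ₂ = x ^ 2 + (1 - x) * cc := by rw [hcc]; field_simp; ring
  have hac0 : 0 ≤ ac := div_nonneg (by linarith) hε.le
  have hcc0 : 0 ≤ cc := div_nonneg (by linarith) hε.le
  have hxx : x * (1 - x) = x - x ^ 2 := by ring
  have hacx : ac < x := by rw [hac, div_lt_iff₀ hε, hxx]; linarith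
  have hccx : cc < x := by rw [hcc, div_lt_iff₀ hε, hxx]; linarith
  have hmem : ∀ k, k ∈ Sᶜ → k ≠ ℓ₁ ∧ k ≠ ℓ₂ := by
    intro k hk
    rw [Finset.mem_compl, hS, Finset.mem_insert, Finset.mem_insert] at hk
    push Not at hk
    exact ⟨hk.2.1, hk.1⟩
  have hxA : x * (A : ℝ) ≤ m := by
    rw [hAdef, hmdef, Nat.cast_sum, Finset.mul_sum]
    refine Finset.sum_le_sum fun k hk => ?_
    have h1 := hheavy k (hmem k hk).1 (hmem k hk).2
    have h2 : (0 : ℝ) ≤ (a k : ℝ) := Nat.cast_nonneg _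
    have := mul_le_mul_of_nonneg_left h1 h2
    linarith
  have hmA' : m ≤ (A : ℝ) := by
    rw [hAdef, hmdef, Nat.cast_sum]
    refine Finset.sum_le_sum fun k _ => ?_
    have h2 : (0 : ℝ) ≤ (a k : ℝ) := Nat.cast_nonneg _
    have := mul_le_mul_of_nonneg_left (hp1 k) h2
    linarith
  have hcr : (2 * j : ℝ) < m + ((a ℓ₁ : ℝ) * ac + (a ℓ₂ : ℝ) * cc) := by
    have e1 : (a ℓ₁ : ℝ) * ((p ℓ₁ - x ^ 2) / (1 - x)) = (a ℓ₁ : ℝ) * ac := by rw [hac]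
    have e2 : (a ℓ₂ : ℝ) * ((p ℓ₂ - x ^ 2) / (1 - x)) = (a ℓ₂ : ℝ) * cc := by rw [hcc]
    linarith [hcredit, e1, e2]
  have hBjR : (a ℓ₁ : ℝ) ≤ j := by exact_mod_cast hBj
  have hbBR : (a ℓ₂ : ℝ) ≤ a ℓ₁ := by exact_mod_cast hsz
  have hb0R : (0 : ℝ) ≤ a ℓ₂ := Nat.cast_nonneg _
  have hB0R : (0 : ℝ) ≤ a ℓ₁ := Nat.cast_nonneg _
  have hA2 : (A : ℝ) ≤ 2 * j := by exact_mod_cast hA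
  have hj1 : (1 : ℝ) ≤ j := by
    have : 1 ≤ j := le_trans hb1 (le_trans hsz hBj)
    exact_mod_cast this
  have hGA : p ℓ₁ * (A : ℝ) < j := hnm1
  have hgA : p ℓ₂ * (A : ℝ) < j := hnm2
  -- `K < x (a ℓ₁ + a ℓ₂)`
  have hKlt : (a ℓ₁ : ℝ) * ac + (a ℓ₂ : ℝ) * cc < x * (a ℓ₁ : ℝ) + x * (a ℓ₂ : ℝ) := by
    have hb1R : (1 : ℝ) ≤ a ℓ₂ := by exact_mod_cast hb1
    have e1 : (a ℓ₁ : ℝ) * ac ≤ (a ℓ₁ : ℝ) * x := mul_le_mul_of_nonneg_left hacx.le hB0R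
    have e2 : (a ℓ₂ : ℝ) * cc < (a ℓ₂ : ℝ) * x := mul_lt_mul_of_pos_left hccx (by linarith)
    linarith
  have hxa1 : x * (a ℓ₁ : ℝ) ≤ (a ℓ₁ : ℝ) := mul_le_of_le_one_left (Nat.cast_nonneg _) hx1.le
  have hxa2 : x * (a ℓ₂ : ℝ) ≤ (a ℓ₂ : ℝ) := mul_le_of_le_one_left (Nat.cast_nonneg _) hx1.le
  -- `F` at the levels `t ∈ [1, a ℓ₂]` and `t ≤ 0`
  have hFtop : ∀ t : ℕ, 1 ≤ t → t ≤ a ℓ₂ →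
      p ℓ₁ * p ℓ₂ * (if t ≤ a ℓ₁ + a ℓ₂ then (1 : ℝ) else 0) + p ℓ₁ * (1 - p ℓ₂) * (if t ≤ a ℓ₁ then (1 : ℝ) else 0) +
        (1 - p ℓ₁) * p ℓ₂ * (if t ≤ a ℓ₂ then (1 : ℝ) else 0) + (1 - p ℓ₁) * (1 - p ℓ₂) * (if t ≤ 0 then (1 : ℝ) else 0) =
      1 - (1 - p ℓ₁) * (1 - p ℓ₂) := by
    intro t ht1 ht2
    rw [if_pos (by omega), if_pos (by omega), if_pos ht2, if_neg (by omega)]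
    ring
  have hFone : ∀ t : ℕ, t = 0 →
      p ℓ₁ * p ℓ₂ * (if t ≤ a ℓ₁ + a ℓ₂ then (1 : ℝ) else 0) + p ℓ₁ * (1 - p ℓ₂) * (if t ≤ a ℓ₁ then (1 : ℝ) else 0) +
        (1 - p ℓ₁) * p ℓ₂ * (if t ≤ a ℓ₂ then (1 : ℝ) else 0) + (1 - p ℓ₁) * (1 - p ℓ₂) * (if t ≤ 0 then (1 : ℝ) else 0) = 1 := by
    intro t ht
    subst ht
    rw [if_pos (by omega), if_pos (by omega), if_pos (by omega), if_pos le_rfl]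
    ring
  refine tail_ge_of_pairChords p a hp0 hp1 ℓ₁ ℓ₂ hne j x (fun n hn hnm => ?_) (fun n₁ n₂ h1 h2 h3 => ?_)
  · -- integer case `n = m`
    by_cases hnj : n ≤ j
    · have hnR : (n : ℝ) ≤ j := by exact_mod_cast hnj
      have hcr' : (2 * j : ℝ) < (n : ℝ) + ((a ℓ₁ : ℝ) * ac + (a ℓ₂ : ℝ) * cc) := by rw [hnm]; exact hcr
      have hnlo : j + 1 - n ≤ a ℓ₂ := by
        have : (2 * j : ℝ) < (n : ℝ) + (x * (a ℓ₁ : ℝ) + x * (a ℓ₂ : ℝ)) := by linarith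
        have h' : (j : ℝ) - (a ℓ₂ : ℝ) < n := by linarith
        have h'' : (j : ℤ) - (a ℓ₂ : ℤ) < n := by exact_mod_cast h'
        omega
      rw [hFtop (j + 1 - n) (by omega) hnlo]
      have hσ := twoLight_unit_credit ac cc (a ℓ₁) (a ℓ₂) j n n hac0 hcc0 hb0R hbBR hBjR le_rfl hnR hcr'
      have hcr'' : 1 - x ≤ (p ℓ₁ - x ^ 2) + (p ℓ₂ - x ^ 2) := by
        have := mul_le_mul_of_nonneg_left hσ.le hε.le
        rw [hG, hg]; linarith
      have := lightPair_closure_of_unit_credit x (p ℓ₁) (p ℓ₂) hx.le hx1 h1hi.le h2hi.le hcr''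
      linarith
    · rw [hFone (j + 1 - n) (by omega)]
      exact hx1.le
  · -- chord `n₁ < m < n₂ ≤ A`
    have hn2A : (n₂ : ℝ) ≤ A := by exact_mod_cast h3
    have hn12 : (n₁ : ℝ) < n₂ := lt_trans h1 h2
    have hn12N : n₁ < n₂ := by exact_mod_cast hn12
    have hn10 : (0 : ℝ) ≤ n₁ := Nat.cast_nonneg _
    by_cases hn2j : n₂ ≤ j
    · -- upper end in the top light level: cells C5–C7
      have hn2jR : (n₂ : ℝ) ≤ j := by exact_mod_cast hn2j
      have ht2 : j + 1 - n₂ ≤ a ℓ₂ := by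
        have : (2 * j : ℝ) < (n₂ : ℝ) + (x * (a ℓ₁ : ℝ) + x * (a ℓ₂ : ℝ)) := by linarith
        have h' : (j : ℝ) - (a ℓ₂ : ℝ) < n₂ := by linarith
        have h'' : (j : ℤ) - (a ℓ₂ : ℤ) < n₂ := by exact_mod_cast h'
        omega
      rw [hFtop (j + 1 - n₂) (by omega) ht2]
      have hBb : j + 1 ≤ a ℓ₁ + a ℓ₂ := by
        have : (2 * j : ℝ) < (n₂ : ℝ) + (x * (a ℓ₁ : ℝ) + x * (a ℓ₂ : ℝ)) := by linarith
        have h' : (j : ℝ) < (a ℓ₁ : ℝ) + (a ℓ₂ : ℝ) := by linarith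
        have h'' : (j : ℤ) < (a ℓ₁ : ℤ) + (a ℓ₂ : ℤ) := by exact_mod_cast h'
        omega
      by_cases hC7 : j + 1 - n₁ ≤ a ℓ₂
      · rw [hFtop (j + 1 - n₁) (by omega) hC7]
        exact twoLight_cellC7 x ac cc (p ℓ₁) (p ℓ₂) (a ℓ₁) (a ℓ₂) j n₁ n₂ m hx hx1 hac0 hacx.le hcc0 hccx.le hG hg
          hb0R hbBR hBjR hn12.le h2.le hn2jR hcr
      · by_cases hC6 : j + 1 - n₁ ≤ a ℓ₁
        · rw [if_pos (by omega), if_pos hC6, if_neg hC7, if_neg (by omega)]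
          have hval : p ℓ₁ * p ℓ₂ * 1 + p ℓ₁ * (1 - p ℓ₂) * 1 + (1 - p ℓ₁) * p ℓ₂ * 0 + (1 - p ℓ₁) * (1 - p ℓ₂) * 0 = p ℓ₁ := by
            ring
          rw [hval]
          have hcellhi : (n₁ : ℝ) ≤ (j : ℝ) - (a ℓ₂ : ℝ) := by
            have : n₁ + a ℓ₂ ≤ j := by omega
            have h' : ((n₁ + a ℓ₂ : ℕ) : ℝ) ≤ j := by exact_mod_cast this
            push_cast at h'
            linarith
          exact twoLight_cellC6 x ac cc (p ℓ₁) (p ℓ₂) (a ℓ₁) (a ℓ₂) j n₁ n₂ m hx hx1 hac0 hacx.le hcc0 hccx.le hG hg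
            hBjR hn10 hn12 hn2jR hcellhi hcr
        · rw [if_pos (by omega), if_neg hC6, if_neg hC7, if_neg (by omega)]
          have hval : p ℓ₁ * p ℓ₂ * 1 + p ℓ₁ * (1 - p ℓ₂) * 0 + (1 - p ℓ₁) * p ℓ₂ * 0 + (1 - p ℓ₁) * (1 - p ℓ₂) * 0 =
              p ℓ₁ * p ℓ₂ := by ring
          rw [hval]
          have hcellhi : (n₁ : ℝ) ≤ (j : ℝ) - (a ℓ₁ : ℝ) := by
            have : n₁ + a ℓ₁ ≤ j := by omega
            have h' : ((n₁ + a ℓ₁ : ℕ) : ℝ) ≤ j := by exact_mod_cast this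
            push_cast at h'
            linarith
          exact twoLight_cellC5 x ac cc (p ℓ₁) (p ℓ₂) (a ℓ₁) (a ℓ₂) j n₁ n₂ A m hx hx1 hac0 hacx hcc0 hccx hG hg
            hb0R hbBR hn10 h1 h2 hn2jR hn2A hxA hcellhi hcr
    · -- upper end above `j`: level `1`; reduce to `n₂ = A` and use cells C1–C4
      have hn2j' : j + 1 ≤ n₂ := by omega
      rw [hFone (j + 1 - n₂) (by omega)]
      have hjA : (j : ℝ) ≤ A := by
        have : j + 1 ≤ A := le_trans hn2j' h3
        have h' : ((j + 1 : ℕ) : ℝ) ≤ A := by exact_mod_cast this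
        push_cast at h'
        linarith
      by_cases hC1top : j + 1 ≤ n₁
      · -- `F(j+1−n₁) = 1`: the chord value is `n₂ − n₁`
        rw [hFone (j + 1 - n₁) (by omega)]
        have := mul_le_mul_of_nonneg_right hx1.le (sub_nonneg.2 hn12.le)
        linarith
      · by_cases hC4 : j + 1 - n₁ ≤ a ℓ₂
        · -- cell C4
          rw [hFtop (j + 1 - n₁) (by omega) hC4]
          refine twoLight_chord_top_reduce x _ n₁ n₂ A m h1.le h2.le hn2A (fun _ => ?_) hx1.le
          have hn1j : (n₁ : ℝ) ≤ j := by
            have : n₁ ≤ j := by omega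
            exact_mod_cast this
          exact twoLight_cellC4 x ac cc (p ℓ₁) (p ℓ₂) (a ℓ₁) (a ℓ₂) j n₁ A m hx hx1 hac0 hacx.le hcc0 hccx.le hG hg
            hb0R (le_trans hbBR hBjR) hBjR h1 hmA' hn1j hA2 hcr
        · by_cases hC3 : j + 1 - n₁ ≤ a ℓ₁
          · -- cell C3
            rw [if_pos (by omega), if_pos hC3, if_neg hC4, if_neg (by omega)]
            have hval : p ℓ₁ * p ℓ₂ * 1 + p ℓ₁ * (1 - p ℓ₂) * 1 + (1 - p ℓ₁) * p ℓ₂ * 0 + (1 - p ℓ₁) * (1 - p ℓ₂) * 0 = p ℓ₁ := by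
              ring
            rw [hval]
            refine twoLight_chord_top_reduce x _ n₁ n₂ A m h1.le h2.le hn2A (fun _ => ?_) hx1.le
            have hcell : (n₁ : ℝ) ≤ (j : ℝ) - (a ℓ₂ : ℝ) := by
              have : n₁ + a ℓ₂ ≤ j := by omega
              have h' : ((n₁ + a ℓ₂ : ℕ) : ℝ) ≤ j := by exact_mod_cast this
              push_cast at h'
              linarith
            exact twoLight_cellC3 x ac cc (p ℓ₁) (a ℓ₁) (a ℓ₂) j n₁ A m hx hx1 hac0 hacx.le hccx.le hG
              hb0R hBjR hxA hmA' hjA hA2 hcell hcr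
          · by_cases hC2 : j + 1 - n₁ ≤ a ℓ₁ + a ℓ₂
            · -- cell C2
              rw [if_pos hC2, if_neg hC3, if_neg hC4, if_neg (by omega)]
              have hval : p ℓ₁ * p ℓ₂ * 1 + p ℓ₁ * (1 - p ℓ₂) * 0 + (1 - p ℓ₁) * p ℓ₂ * 0 + (1 - p ℓ₁) * (1 - p ℓ₂) * 0 =
                  p ℓ₁ * p ℓ₂ := by ring
              rw [hval]
              refine twoLight_chord_top_reduce x _ n₁ n₂ A m h1.le h2.le hn2A (fun _ => ?_) hx1.le
              have hcell : (n₁ : ℝ) ≤ (j : ℝ) - (a ℓ₁ : ℝ) := by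
                have : n₁ + a ℓ₁ ≤ j := by omega
                have h' : ((n₁ + a ℓ₁ : ℕ) : ℝ) ≤ j := by exact_mod_cast this
                push_cast at h'
                linarith
              have hmAlt : m < (A : ℝ) := lt_of_lt_of_le h2 hn2A
              exact twoLight_cellC2 x ac cc (p ℓ₁) (p ℓ₂) (a ℓ₁) (a ℓ₂) j n₁ A m hx hx1 hac0 hacx.le hcc0 hccx.le hG hg
                hb0R hbBR hxA hmAlt hjA hA2 hcell hcr
            · -- cell C1
              rw [if_neg hC2, if_neg hC3, if_neg hC4, if_neg (by omega)]
              have hval : p ℓ₁ * p ℓ₂ * 0 + p ℓ₁ * (1 - p ℓ₂) * 0 + (1 - p ℓ₁) * p ℓ₂ * 0 + (1 - p ℓ₁) * (1 - p ℓ₂) * 0 =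
                  (0 : ℝ) := by ring
              rw [hval]
              refine twoLight_chord_top_reduce x _ n₁ n₂ A m h1.le h2.le hn2A (fun _ => ?_) hx1.le
              have hcell : (n₁ : ℝ) ≤ (j : ℝ) - (a ℓ₁ : ℝ) - (a ℓ₂ : ℝ) := by
                have : n₁ + a ℓ₁ + a ℓ₂ ≤ j := by omega
                have h' : ((n₁ + a ℓ₁ + a ℓ₂ : ℕ) : ℝ) ≤ j := by exact_mod_cast this
                push_cast at h'
                linarith
              exact twoLight_cellC1 x ac cc (p ℓ₁) (p ℓ₂) (a ℓ₁) (a ℓ₂) j n₁ A m hx hx1 hac0 hacx.le hccx.le hG hg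
                hb0R hB0R hj1 hn10 hxA hA2 hcell hcr hGA hgA

/-- One light blob heavy-mergeable ⟹ the row, via p1 g11's λ⁺ `tail_ge_of_heavyMerge_oneLight` with `x₀` the OTHER light
(bridging: the heavy set seen from `x₀` is the complement of the two lights; the mergeable light counts at full credit). [this work] -/
theorem tail_ge_of_twoLights_mergeOne {κ : Type*} [Fintype κ] [DecidableEq κ] (p : κ → ℝ) (a : κ → ℕ) (x : ℝ) (j : ℕ)
    (hx : 1 / 2 < x) (hx1 : x < 1) (hp0 : ∀ i, 0 ≤ p i) (hp1 : ∀ i, p i ≤ 1) (ℓ x₀ : κ) (hne : ℓ ≠ x₀) (hj : 1 ≤ j)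
    (hbj : a x₀ ≤ j) (hℓhi : p ℓ < x) (h0lo : x ^ 2 ≤ p x₀) (h0hi : p x₀ < x)
    (hheavy : ∀ k, k ≠ ℓ → k ≠ x₀ → x ≤ p k)
    (hmerge : (j : ℝ) ≤ p ℓ * ((∑ k ∈ (insert x₀ (insert ℓ (∅ : Finset κ)))ᶜ, a k : ℕ) : ℝ))
    (hcredit : (2 * j : ℝ) < (∑ k ∈ (insert x₀ (insert ℓ (∅ : Finset κ)))ᶜ, (a k : ℝ) * p k) +
      (a ℓ : ℝ) * ((p ℓ - x ^ 2) / (1 - x)) + (a x₀ : ℝ) * ((p x₀ - x ^ 2) / (1 - x))) :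
    x ≤ ∑ s : Finset κ, (∏ i, (if i ∈ s then p i else 1 - p i)) * (if j + 1 ≤ ∑ i ∈ s, a i then (1 : ℝ) else 0) := by
  set S : Finset κ := insert x₀ (insert ℓ (∅ : Finset κ)) with hS
  have hε : 0 < 1 - x := by linarith
  have hx0 : 0 < x := by linarith
  -- the heavy set seen from `x₀`
  have hset : (Finset.univ : Finset κ).filter (fun i => i ≠ x₀ ∧ x ≤ p i) = Sᶜ := by
    ext i
    rw [Finset.mem_filter, Finset.mem_compl, hS, Finset.mem_insert, Finset.mem_insert]
    constructor
    · rintro ⟨-, hi0, hix⟩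
      push Not
      refine ⟨hi0, fun h => ?_, Finset.notMem_empty _⟩
      rw [h] at hix; linarith
    · intro hi
      push Not at hi
      exact ⟨Finset.mem_univ _, hi.1, hheavy i hi.2.1 hi.1⟩
  have hM : ∀ k, k ≠ x₀ → p k < x →
      (j : ℝ) ≤ p k * ∑ i ∈ (Finset.univ : Finset κ).filter (fun i => i ≠ x₀ ∧ x ≤ p i), (a i : ℝ) := by
    intro k hk0 hkx
    have hk : k = ℓ := by
      by_contra h
      have := hheavy k h hk0
      linarith
    subst hk
    rw [hset, ← Nat.cast_sum]
    exact hmerge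
  have hH : ∀ k, k ≠ x₀ → p k < x → ∃ i, i ≠ x₀ ∧ x ≤ p i ∧ 0 < a i := by
    intro k _ _
    by_contra hnone
    push Not at hnone
    have hA0 : ∑ i ∈ Sᶜ, a i = 0 := by
      refine Finset.sum_eq_zero fun i hi => ?_
      rw [← hset, Finset.mem_filter] at hi
      have := hnone i hi.2.1 hi.2.2
      omega
    rw [hA0] at hmerge
    simp only [Nat.cast_zero, mul_zero] at hmerge
    have : (1 : ℝ) ≤ j := by exact_mod_cast hj
    linarith
  -- credit: the mergeable light at full credit `a ℓ · p ℓ ≥ a ℓ · κ(p ℓ)`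
  have hcredit' : (2 * j : ℝ) < (∑ k ∈ Finset.univ.erase x₀, (a k : ℝ) * p k) + a x₀ * ((p x₀ - x ^ 2) / (1 - x)) := by
    have herase : Finset.univ.erase x₀ = insert ℓ Sᶜ := by
      ext i
      rw [Finset.mem_erase, Finset.mem_insert, Finset.mem_compl, hS, Finset.mem_insert, Finset.mem_insert]
      constructor
      · rintro ⟨hi0, -⟩
        by_cases h : i = ℓ
        · exact Or.inl h
        · right; push Not; exact ⟨hi0, h, Finset.notMem_empty _⟩
      · rintro (h | h)
        · exact ⟨by rw [h]; exact hne, Finset.mem_univ _⟩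
        · push Not at h; exact ⟨h.1, Finset.mem_univ _⟩
    have hℓS : ℓ ∉ Sᶜ := by rw [Finset.mem_compl, hS]; simp
    rw [herase, Finset.sum_insert hℓS]
    have hκ : (a ℓ : ℝ) * ((p ℓ - x ^ 2) / (1 - x)) ≤ (a ℓ : ℝ) * p ℓ := by
      refine mul_le_mul_of_nonneg_left ?_ (Nat.cast_nonneg _)
      rw [div_le_iff₀ hε]
      have := mul_le_mul_of_nonneg_left hℓhi.le (hp0 ℓ)
      nlinarith [this]
    linarith [hcredit, hκ]
  have h := tail_ge_of_heavyMerge_oneLight p a x₀ x j hp0 hp1 hx0 hx1 h0lo h0hi.le hbj hM hH hcredit'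
  -- convert the conclusion
  rw [Finset.sum_filter] at h
  refine le_trans h (le_of_eq (Finset.sum_congr rfl fun s _ => ?_))
  split_ifs <;> simp

/-- **DIB\* ON THE CORNER WITH TWO LIGHT BLOBS** (floor `1/2 < x < 1`, heavy total `≤ 2j`).  See the module docstring. [this work] -/
theorem tail_ge_of_twoLights_corner {κ : Type*} [Fintype κ] [DecidableEq κ] (p : κ → ℝ) (a : κ → ℕ) (x : ℝ) (j : ℕ)
    (hx : 1 / 2 < x) (hx1 : x < 1) (hp0 : ∀ i, 0 ≤ p i) (hp1 : ∀ i, p i ≤ 1) (ℓ₁ ℓ₂ : κ) (hne : ℓ₁ ≠ ℓ₂)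
    (hsz : a ℓ₂ ≤ a ℓ₁) (hb1 : 1 ≤ a ℓ₂) (hBj : a ℓ₁ ≤ j)
    (h1lo : x ^ 2 ≤ p ℓ₁) (h1hi : p ℓ₁ < x) (h2lo : x ^ 2 ≤ p ℓ₂) (h2hi : p ℓ₂ < x)
    (hheavy : ∀ k, k ≠ ℓ₁ → k ≠ ℓ₂ → x ≤ p k)
    (hA : ∑ k ∈ (insert ℓ₂ (insert ℓ₁ (∅ : Finset κ)))ᶜ, a k ≤ 2 * j)
    (hcredit : (2 * j : ℝ) < (∑ k ∈ (insert ℓ₂ (insert ℓ₁ (∅ : Finset κ)))ᶜ, (a k : ℝ) * p k) +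
      (a ℓ₁ : ℝ) * ((p ℓ₁ - x ^ 2) / (1 - x)) + (a ℓ₂ : ℝ) * ((p ℓ₂ - x ^ 2) / (1 - x))) :
    x ≤ ∑ s : Finset κ, (∏ i, (if i ∈ s then p i else 1 - p i)) * (if j + 1 ≤ ∑ i ∈ s, a i then (1 : ℝ) else 0) := by
  have hj : 1 ≤ j := le_trans hb1 (le_trans hsz hBj)
  by_cases hM1 : (j : ℝ) ≤ p ℓ₁ * ((∑ k ∈ (insert ℓ₂ (insert ℓ₁ (∅ : Finset κ)))ᶜ, a k : ℕ) : ℝ)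
  · -- merge `ℓ₁`, keep `x₀ = ℓ₂`
    exact tail_ge_of_twoLights_mergeOne p a x j hx hx1 hp0 hp1 ℓ₁ ℓ₂ hne hj (le_trans hsz hBj) h1hi h2lo h2hi
      hheavy hM1 hcredit
  · by_cases hM2 : (j : ℝ) ≤ p ℓ₂ * ((∑ k ∈ (insert ℓ₂ (insert ℓ₁ (∅ : Finset κ)))ᶜ, a k : ℕ) : ℝ)
    · -- merge `ℓ₂`, keep `x₀ = ℓ₁`
      have hS' : insert ℓ₁ (insert ℓ₂ (∅ : Finset κ)) = insert ℓ₂ (insert ℓ₁ (∅ : Finset κ)) := Finset.insert_comm _ _ _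
      have hheavy' : ∀ k, k ≠ ℓ₂ → k ≠ ℓ₁ → x ≤ p k := fun k h2 h1 => hheavy k h1 h2
      have hM2' : (j : ℝ) ≤ p ℓ₂ * ((∑ k ∈ (insert ℓ₁ (insert ℓ₂ (∅ : Finset κ)))ᶜ, a k : ℕ) : ℝ) := by rw [hS']; exact hM2
      have hcredit' : (2 * j : ℝ) < (∑ k ∈ (insert ℓ₁ (insert ℓ₂ (∅ : Finset κ)))ᶜ, (a k : ℝ) * p k) +
          (a ℓ₂ : ℝ) * ((p ℓ₂ - x ^ 2) / (1 - x)) + (a ℓ₁ : ℝ) * ((p ℓ₁ - x ^ 2) / (1 - x)) := by rw [hS']; linarith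
      exact tail_ge_of_twoLights_mergeOne p a x j hx hx1 hp0 hp1 ℓ₂ ℓ₁ hne.symm hj hBj h2hi h1lo h1hi hheavy' hM2' hcredit'
    · exact tail_ge_of_twoLights_noMerge p a x j hx hx1 hp0 hp1 ℓ₁ ℓ₂ hne hsz hb1 hBj h1lo h1hi h2lo h2hi hheavy hA
        (not_le.mp hM1) (not_le.mp hM2) hcredit

end IndepBlob

end Quant

end Summit.CriticalPhenomena.PercolationContinuityZ3.Theorems
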